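import Summits.QuantumAdvantage.AdviceFreeQNC0.LevelSetTransfer
import HarnessLib

/-!
# Cell qa-qnc0 (rung F-Q1, route RingFrame, crux α, line `product`): additive LDMA ⟹ far-set
# balance — the converse direction of the level-set normal form, with honest constants

Planner qa-qnc0-p1's TARGET §20.7(b) states "additive LDMA ⟺ far-set balance at all constant
scales"; `LevelSetTransfer.lean` proves `FSB ⟹ LDMAAdd` (`ldmaAdd_of_fsb`).  Here the converse:

* `fsb_of_ldmaAdd`: `LDMAAdd κ E ⟹ FSB c (κτ) τ (τ/c + E)` for every ratio `c > 0` and scale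
  `τ ≥ 0` (the `τ`-far rows cost `≥ τ·2^{L'}` each; class `r` costs `≤ 2^{L'}` per row on
  `FAR_{τ/c} ∩ cls r` and `< (τ/c)·2^{L'}` per row elsewhere);
* `fsb_of_ldma_scale`: `LDMAAdd κ 0 ⟹ FSB c (κτ) τ τ` for all `τ > 0`, `c ≥ 1`.

The constant `κ' = κτ` depends on the scale: the weight ↔ indicator conversion loses the factor
`τ`.  `Sketch8b.FSBOfLDMA` as typed asks for ONE `κ'` serving every `τ`; that quantifier order does
not follow from the conversion (cost profiles consistent with `LDMAAdd κ 0` violate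
`FSB c κ' τ τ` for `τ < 2κ'/(3 + 2κ/(1−κ))`; whether column-degree-`D` maps realise them is the
crux itself) — qn-lit LIT-MEMO-13 §3.  WHAT THIS IS NOT: nothing on `FSB`/`FW`/`LDRAgg` at general
column degree; α untouched; no separation claim.
-/

noncomputable section

namespace Summit.QuantumAdvantage.AdviceFreeQNC0

open Finset
open Literature.Computability.MetaComplexity Literature.Computability.MetaComplexity.Smolensky

/-! ### The converse: additive LDMA gives far-set balance (scale-dependent constant) -/

/-- **Additive LDMA ⟹ far-set balance** (the converse direction of TARGET §20.7(b) "additive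
LDMA ⟺ far-set balance", in its honest quantitative form): `LDMAAdd κ E` gives
`FSB c (κτ) τ (τ/c + E)` for every ratio `c > 0` and scale `τ ≥ 0` — the `τ`-far rows cost
`≥ τ·2^{L'}` each, while class `r` costs at most `2^{L'}` per row on `FAR_{τ/c} ∩ cls r` and
`< (τ/c)·2^{L'}` per row elsewhere.  The constant `κ' = κτ` depends on the scale (the
weight ↔ indicator conversion loses the factor `τ`); the quantifier order `∃ κ', ∀ τ` of
`Sketch8b.FSBOfLDMA` does NOT follow from this conversion (qn-lit LIT-MEMO-13 §3). -/
theorem fsb_of_ldmaAdd {κ E c τ : ℝ} (hκ : 0 ≤ κ) (hc : 0 < c) (hτ : 0 ≤ τ) (h : LDMAAdd κ E) :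
    FSB c (κ * τ) τ (τ / c + E) := by
  intro C
  obtain ⟨L₀, hL₀⟩ := h C
  refine ⟨L₀, fun L L' hL hL' D hD Γ hΓ r => ?_⟩
  have hld := hL₀ L L' hL hL' D hD Γ hΓ r
  have h2L : (0 : ℝ) ≤ (2 : ℝ) ^ L := by positivity
  have h2L' : (0 : ℝ) < (2 : ℝ) ^ L' := by positivity
  -- (1) total cost ≥ τ·2^{L'}·|FAR_τ|
  have htot : τ * (2 : ℝ) ^ L' * ((far D Γ τ).card : ℝ) ≤
      ((∑ u : Fin L → Bool, distFail D (Γ u) : ℕ) : ℝ) := by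
    push_cast
    calc τ * (2 : ℝ) ^ L' * ((far D Γ τ).card : ℝ) = ∑ _u ∈ far D Γ τ, τ * (2 : ℝ) ^ L' := by
          rw [Finset.sum_const, nsmul_eq_mul]; ring
      _ ≤ ∑ u ∈ far D Γ τ, (distFail D (Γ u) : ℝ) :=
          Finset.sum_le_sum fun u hu => by
            unfold far at hu
            exact (Finset.mem_filter.1 hu).2
      _ ≤ ∑ u : Fin L → Bool, (distFail D (Γ u) : ℝ) :=
          Finset.sum_le_sum_of_subset_of_nonneg (Finset.subset_univ _) (fun u _ _ => by positivity)
  -- (2) class-`r` cost ≤ 2^{L'}·|FAR_{τ/c} ∩ cls r| + (τ/c)·2^{L+L'}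
  have hcls : ((∑ u ∈ cls L r, distFail D (Γ u) : ℕ) : ℝ) ≤
      (2 : ℝ) ^ L' * ((far D Γ (τ / c) ∩ cls L r).card : ℝ) + τ / c * (2 : ℝ) ^ (L + L') := by
    push_cast
    set P : (Fin L → Bool) → Prop := fun u => τ / c * (2 : ℝ) ^ L' ≤ (distFail D (Γ u) : ℝ)
      with hP
    have hsplit : ∑ u ∈ cls L r, (distFail D (Γ u) : ℝ) =
        (∑ u ∈ (cls L r).filter P, (distFail D (Γ u) : ℝ)) +
          ∑ u ∈ (cls L r).filter (fun u => ¬ P u), (distFail D (Γ u) : ℝ) :=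
      (Finset.sum_filter_add_sum_filter_not _ _ _).symm
    have hset : (cls L r).filter P = far D Γ (τ / c) ∩ cls L r := by
      ext u
      unfold far
      simp only [hP, Finset.mem_filter, Finset.mem_inter, Finset.mem_univ, true_and]
      exact and_comm
    have hfarpart : ∑ u ∈ (cls L r).filter P, (distFail D (Γ u) : ℝ) ≤
        (2 : ℝ) ^ L' * ((far D Γ (τ / c) ∩ cls L r).card : ℝ) := by
      rw [hset]
      calc ∑ u ∈ far D Γ (τ / c) ∩ cls L r, (distFail D (Γ u) : ℝ)
          ≤ ∑ _u ∈ far D Γ (τ / c) ∩ cls L r, (2 : ℝ) ^ L' :=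
            Finset.sum_le_sum fun u _ => by exact_mod_cast distFail_le_pow D (Γ u)
        _ = (2 : ℝ) ^ L' * ((far D Γ (τ / c) ∩ cls L r).card : ℝ) := by
            rw [Finset.sum_const, nsmul_eq_mul]; ring
    have hnearpart : ∑ u ∈ (cls L r).filter (fun u => ¬ P u), (distFail D (Γ u) : ℝ) ≤
        τ / c * (2 : ℝ) ^ (L + L') := by
      calc ∑ u ∈ (cls L r).filter (fun u => ¬ P u), (distFail D (Γ u) : ℝ)
          ≤ ∑ _u ∈ (cls L r).filter (fun u => ¬ P u), τ / c * (2 : ℝ) ^ L' :=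
            Finset.sum_le_sum fun u hu => by
              have h := (Finset.mem_filter.1 hu).2
              rw [hP] at h
              exact (not_le.1 h).le
        _ = (((cls L r).filter (fun u => ¬ P u)).card : ℝ) * (τ / c * (2 : ℝ) ^ L') := by
            rw [Finset.sum_const, nsmul_eq_mul]
        _ ≤ (2 : ℝ) ^ L * (τ / c * (2 : ℝ) ^ L') := by
            refine mul_le_mul_of_nonneg_right ?_ (by positivity)
            have : ((cls L r).filter (fun u => ¬ P u)).card ≤ 2 ^ L := by
              calc ((cls L r).filter (fun u => ¬ P u)).card ≤ (univ : Finset (Fin L → Bool)).card :=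
                    Finset.card_le_card (Finset.subset_univ _)
                _ = 2 ^ L := by
                    rw [Finset.card_univ, Fintype.card_fun, Fintype.card_bool, Fintype.card_fin]
            exact_mod_cast this
        _ = τ / c * (2 : ℝ) ^ (L + L') := by rw [pow_add]; ring
    rw [hsplit]
    linarith
  -- (3) combine: κ·τ·2^{L'}·|FAR_τ| ≤ κ·Σφ ≤ Σ_{cls r}φ + E·2^{L+L'} ≤ …
  have hk : κ * (τ * (2 : ℝ) ^ L' * ((far D Γ τ).card : ℝ)) ≤
      κ * (((∑ u : Fin L → Bool, distFail D (Γ u) : ℕ) : ℝ)) :=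
    mul_le_mul_of_nonneg_left htot hκ
  have hpow : (2 : ℝ) ^ (L + L') = (2 : ℝ) ^ L * (2 : ℝ) ^ L' := pow_add _ _ _
  rw [hpow] at hcls hld
  have key : (2 : ℝ) ^ L' * (κ * τ * ((far D Γ τ).card : ℝ) - (τ / c + E) * (2 : ℝ) ^ L) ≤
      (2 : ℝ) ^ L' * ((far D Γ (τ / c) ∩ cls L r).card : ℝ) := by
    have e1 : (2 : ℝ) ^ L' * (κ * τ * ((far D Γ τ).card : ℝ) - (τ / c + E) * (2 : ℝ) ^ L) =
        κ * (τ * (2 : ℝ) ^ L' * ((far D Γ τ).card : ℝ)) - τ / c * ((2 : ℝ) ^ L * (2 : ℝ) ^ L')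
          - E * ((2 : ℝ) ^ L * (2 : ℝ) ^ L') := by ring
    rw [e1]
    linarith
  exact le_of_mul_le_mul_left key h2L'

/-- **Multiplicative LDMA ⟹ far-set balance at every scale** (the provable content of
`Sketch8b.FSBOfLDMA`, with the scale-dependent constant made explicit): `LDMAAdd κ 0` gives, for
every `τ > 0` and `c ≥ 1`, `FSB c (κτ) τ τ` (indeed `FSB c (κτ) τ (τ/c)`). -/
theorem fsb_of_ldma_scale {κ : ℝ} (hκ : 0 < κ) (h : LDMAAdd κ 0) {τ c : ℝ} (hτ : 0 < τ)
    (hc : 1 ≤ c) : FSB c (κ * τ) τ τ := by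
  have h1 := fsb_of_ldmaAdd (E := 0) (c := c) (τ := τ) hκ.le (by linarith) hτ.le h
  rw [add_zero] at h1
  -- weaken the slack `τ/c ≤ τ`
  intro C
  obtain ⟨L₀, hL₀⟩ := h1 C
  refine ⟨L₀, fun L L' hL hL' D hD Γ hΓ r => ?_⟩
  have h2 := hL₀ L L' hL hL' D hD Γ hΓ r
  have hslack : τ / c * (2 : ℝ) ^ L ≤ τ * (2 : ℝ) ^ L := by
    refine mul_le_mul_of_nonneg_right ?_ (by positivity)
    exact div_le_self hτ.le hc
  linarith

end Summit.QuantumAdvantage.AdviceFreeQNC0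

end
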